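import Summits.QuantumFields.BalabanUV.T4Continuum.Spine.NE1p.DressedSmallFieldOuterCount

/-!
# T⁴ programme, spine estimate NE1′ (node O3b/H2) — THE COMPONENTS DETERMINING `Z′_i`, ANCHORED: N0v's per-member bound `hmember`
# DISCHARGED from the components' inner counts (N0u's currency), the (2.36)-KIND transfer to the closure `Z′ = cl Z₀`, and the
# anchored (1.26)∕(1.28)-KIND sum — the (2.11)-geometry's `Gk.ineq126` BY NAME; [Balaban1988RGII] p. 19–20 KIND

Cell `pub-balaban`, sub-cell `t4`, BINDER-OWNERS row NE1′; owner lineage t4-ne1p-p1 (PROVER seat P1, «RG-trajectory comparison …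
μ-uniformity through the printed small-field bounds»), generation 29; ADDITIVE — imports the owner's N0v
`Spine/NE1p/DressedSmallFieldOuterCount` ONLY (→ N0u → N0t → N0s → N0r → …); THEOREMS ONLY (0 def, 0 `def … : Prop`, 0 cite); nothing of
N0v ∕ N0u ∕ b13's modules is restated — used BY NAME.

WHY THIS FILE.  N0v's outer-label END displays `hmember : Σ_{j∈J Z′} n Z′ j ≤ a·e^{−r d(Z′)}·e^{−R(d(Z′)+5)}` — the per-member inner bound of a
scale-`(k+1)` domain `Z′_i` of the covering family.  Print fills it on p. 19–20: «For each Z′_i we sum over all possible components of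
Z₀ determining this Z′_i. … A sum over n components is estimated by a product of n sums, each of them is a sum over independently
changing components. The last sum is estimated using (1.28), with κ replaced by δκ, and with an additional sum over (L+2)⁴ cubes □′
from π_k, the cubes touching a fixed LM-cube in Z′_i. This yields a bound similar to (2.35), with ε₂ replaced by (L+2)⁴O(1)ε₂, and
(1−5δ)κd_k(Z_i) in the exponentials replaced by (1−6δ)½Lκd_{k+1}(Z′_i).» — i.e. (i) the inner count of each component (N0u), (ii)
the (2.36) transfer «2d_k(Z_i) ≥ Ld_{k+1}(Z′_i)», (iii) an ANCHORED (1.26)∕(1.28)-type sum over the components whose closure is `Z′_i`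
(print p. 19 cites «(1.28)»; AS PRINTED on p. 8, (1.28) is the volume inequality and the sum-over-domains-containing-a-cube inequality of
this KIND is (1.26) — which §1∕§2 type as the (2.11)-geometry's field `Gk.ineq126` BY NAME; locating note of the crew's pre-read X166 (P3) adopted).
On the cell's format (inner datum of a member `Z′` = a pair `⟨Z₀, l⟩`, `Z₀` a scale-`k` domain with `cl Z₀ = Z′`, `l ∈ I Z₀` one of its
inner labels; weight `ε·m Z₀ l`):
* §1 `fibreSum_le_card_anchor_mul` [folklore]: if every `Z₀ ∈ S` with `cl Z₀ = Z′` contains a cube of the anchor set `anc Z′` and the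
  anchored sums `Σ_{Z₀ ∋ c} β Z₀` are `≤ K`, then `Σ_{Z₀ ∈ S, cl Z₀ = Z′} β Z₀ ≤ #(anc Z′)·K` (`Finset.sum_comm` bookkeeping).
* §2 `memberSum_le_of_anchor` (kernel): with the inner counts `Σ_l m Z₀ l ≤ e^{c₀}e^{−R₀ d_k Z₀}` (`hinner`), the rate split
  `R₀ = (R₀ − κ₀) + κ₀`, the transfer `ℓ·d(Z′) ≤ d_k(Z₀)` on the first part (`htransfer`) and §1 with (1.26)'s letters on the second:
  `Σ_{⟨Z₀,l⟩, cl Z₀ = Z′} ε·m Z₀ l ≤ (ε·e^{c₀}·Aₐ·K₀·e^{5R})·e^{−r d(Z′)}·e^{−R(d(Z′)+5)}` when `r + R ≤ (R₀ − κ₀)ℓ`, `κ₀ ≤ R₀`, `#anc Z′ ≤ Aₐ`.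
* §3 END **`attachedPart_locE_le_of_coresAt_pencil_components`** = N0v's `attachedPart_locE_le_of_coresAt_pencil_outerLabels` ONCE BY NAME
  with `κ Z′ := Σ _ : Dk.Dom, ι₀`, `J Z′ := (univ.filter (cl · = Z′)).sigma I`, weights `ε·m`, `hmember` SUPPLIED by §2 with `Gk.ineq126`
  BY NAME and the amplitude `a := ε·e^{c₀}·Aₐ·Gk.K₀·e^{5R}` in N0v's (2.29) clause `h229`; displayed: `hinner` (N0u's SHAPE — its
  `innerCount_le_decay` supplies it for N0u's labels `⟨W, (𝐃, P)⟩` with `c₀ := c₁u − 5R_in`, `R₀ := R_in − c₁u`), `hanchor`∕`hA` (the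
  anchor), `htransfer` ((2.36) KIND; tree: `B13.Ineq236With` shape with the repaired factor `L∕a_L`, GAPS G-B13-09R), N0v's `hlink`,
  `hadm` (terms of `Z` = outer labels with component inner data — (B1b) READING), `hAmp`, clauses.

WHAT THIS DOES TO THE WALL (owner's reading; nothing re-labelled; joins Q47).  With N0s∕N0u∕N0v and this file the WHOLE of
(B3-count) — print's four resummation steps AND the component sum inside the third — is kernel BY NAME on the cell's format, table-blind
and μ-FREE by construction, fed from the two (2.11)-geometries' fields (`ineq126`, `ineq227`, `volBound` at scales `k` and `k+1`) and
b13's PROVED (2.29)∕(2.34)-type lemmas; what stays DISPLAYED of printed KIND is GEOMETRY OF THE DOMAINS ONLY: the links∕transfer ((2.27)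
off-diagonal, (2.32), (2.36)∕(2.37): `hlink` ×2, `htransfer`, `hmono`), the anchor (`hanchor`∕`hA`) and the bonds-per-cube clause — none
of which touches the table; (B3-form)∕(B3-arith) as N0t.  NOTHING of (B3) is discharged on Bałaban's densities; all label
identifications are (B1b) READING; 0 binders instantiated on Bałaban's (2.14) data; wall v1.7 does NOT move; NE1′ NOT printed, NOT
proved; 0∕9; count 9 unchanged.

HONEST FRAMING.  Finite combinatorics + real arithmetic and one by-name application of N0v's END; the quotations above are LOCI of the
audited manuscript [Balaban1988RGII] = CMP 116 (1988) 1–22 (renders `…-p019∕p020-x2.png` read as images this generation), TYPE∕CONTEXT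
only, never hypothesis-free facts; ABSOLUTE RULE honoured; nothing internally minted is cited.  Rung (B)+1 on ONE finite T⁴ — NOT
infinite volume, NOT a mass gap, NOT OS on ℝ⁴, NOT Clay.  HONEST DEPENDENCY: continuum YM on T⁴ ⇐ BetaPertH ∧ nine spine estimates (0/9
proved); BetaPertH ⇐ (D1) ∧ (D4) ∧ CAP+tail; G-an2-4 gates asym, D1 and NE2/3/4.
-/


noncomputable section

namespace Summit.QuantumFields.BalabanUV.T4Continuum.NE1p.DressedSmallFieldComponentCount

open scoped BigOperators

variable {DomK Dom CubeK : Type*} [DecidableEq CubeK] [DecidableEq Dom]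

/-- **THE ANCHORED FIBRE SUM** [folklore]: if every scale-`k` domain `Z₀` of the catalogue `S` whose closure is `Z′` contains a
cube of the anchor set `anc Z′`, and the anchored sums `Σ_{Z₀ ∋ c} β Z₀` are `≤ K` for the anchor cubes (β ≥ 0), then the fibre sum
`Σ_{Z₀ ∈ S, cl Z₀ = Z′} β Z₀ ≤ #(anc Z′)·K` ((1.28)∕p. 19–20 KIND: «a sum over (L+2)⁴ cubes □′ … touching a fixed LM-cube»). -/
theorem fibreSum_le_card_anchor_mul (S : Finset DomK) (cubesK : DomK → Finset CubeK) (cl : DomK → Dom) (anc : Dom → Finset CubeK)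
    (β : DomK → ℝ) (hβ : ∀ Z₀ ∈ S, 0 ≤ β Z₀) {K : ℝ} (Z' : Dom)
    (hanchor : ∀ Z₀ ∈ S, cl Z₀ = Z' → ∃ c ∈ anc Z', c ∈ cubesK Z₀)
    (hK : ∀ c ∈ anc Z', ∑ Z₀ ∈ S.filter (fun Z₀ => c ∈ cubesK Z₀), β Z₀ ≤ K) :
    ∑ Z₀ ∈ S.filter (fun Z₀ => cl Z₀ = Z'), β Z₀ ≤ (anc Z').card * K := by
  classical
  calc ∑ Z₀ ∈ S.filter (fun Z₀ => cl Z₀ = Z'), β Z₀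
      ≤ ∑ Z₀ ∈ S.filter (fun Z₀ => cl Z₀ = Z'), ∑ c ∈ anc Z', (if c ∈ cubesK Z₀ then β Z₀ else 0) := by
        refine Finset.sum_le_sum fun Z₀ hZ₀ => ?_
        obtain ⟨hS, hcl⟩ := Finset.mem_filter.1 hZ₀
        obtain ⟨c, hc, hcZ⟩ := hanchor Z₀ hS hcl
        have h0 : ∀ c' ∈ anc Z', 0 ≤ (if c' ∈ cubesK Z₀ then β Z₀ else 0) := fun c' _ => by
          split_ifs
          · exact hβ Z₀ hS
          · exact le_rfl
        calc β Z₀ = (if c ∈ cubesK Z₀ then β Z₀ else 0) := by rw [if_pos hcZ]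
          _ ≤ ∑ c' ∈ anc Z', (if c' ∈ cubesK Z₀ then β Z₀ else 0) := Finset.single_le_sum h0 hc
    _ = ∑ c ∈ anc Z', ∑ Z₀ ∈ S.filter (fun Z₀ => cl Z₀ = Z'), (if c ∈ cubesK Z₀ then β Z₀ else 0) := Finset.sum_comm
    _ ≤ ∑ c ∈ anc Z', K := by
        refine Finset.sum_le_sum fun c hc => ?_
        calc ∑ Z₀ ∈ S.filter (fun Z₀ => cl Z₀ = Z'), (if c ∈ cubesK Z₀ then β Z₀ else 0)
            ≤ ∑ Z₀ ∈ S, (if c ∈ cubesK Z₀ then β Z₀ else 0) :=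
              Finset.sum_le_sum_of_subset_of_nonneg (Finset.filter_subset _ _) fun Z₀ hZ₀ _ => by
                split_ifs
                · exact hβ Z₀ hZ₀
                · exact le_rfl
          _ = ∑ Z₀ ∈ S.filter (fun Z₀ => c ∈ cubesK Z₀), β Z₀ := by rw [Finset.sum_filter]
          _ ≤ K := hK c hc
    _ = (anc Z').card * K := by rw [Finset.sum_const, nsmul_eq_mul]

/-- **THE MEMBER BOUND FROM THE ANCHORED SUM** (kernel; p. 19–20 KIND: inner count of each component `Z₀` (N0u currency,
`Σ_l m Z₀ l ≤ e^{c₀}·e^{−R₀ d_k Z₀}`), the (2.36)-KIND transfer `ℓ·d(Z′) ≤ d_k(Z₀)` for the components whose closure is `Z′`, and the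
anchored (1.26)∕(1.28)-KIND sum): the weights `ε·m Z₀ l` over the labels `⟨Z₀, l⟩` with `cl Z₀ = Z′` sum to
`≤ (ε·e^{c₀}·A₀·K₀·e^{5R})·e^{−r d(Z′)}·e^{−R(d(Z′)+5)}` when `r + R ≤ (R₀ − κ₀)·ℓ`, `κ₀ ≤ R₀`, `#anc Z′ ≤ A₀`. [folklore] -/
theorem memberSum_le_of_anchor {ι : Type*} (S : Finset DomK) (cubesK : DomK → Finset CubeK) (dK : DomK → ℝ) (cl : DomK → Dom)
    (anc : Dom → Finset CubeK) (d : Dom → ℝ) (I : DomK → Finset ι) (m : DomK → ι → ℝ)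
    {ε c₀ R₀ κ₀ K₀ A₀ ℓ r R : ℝ} (hε : 0 ≤ ε) (hK₀ : 0 ≤ K₀) (Z' : Dom) (hd : 0 ≤ d Z')
    (hinner : ∀ Z₀ ∈ S, ∑ l ∈ I Z₀, m Z₀ l ≤ Real.exp c₀ * Real.exp (-(R₀ * dK Z₀)))
    (h126 : ∀ c ∈ anc Z', ∑ Z₀ ∈ S.filter (fun Z₀ => c ∈ cubesK Z₀), Real.exp (-(κ₀ * dK Z₀)) ≤ K₀)
    (hanchor : ∀ Z₀ ∈ S, cl Z₀ = Z' → ∃ c ∈ anc Z', c ∈ cubesK Z₀) (hA₀ : ((anc Z').card : ℝ) ≤ A₀)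
    (htransfer : ∀ Z₀ ∈ S, cl Z₀ = Z' → ℓ * d Z' ≤ dK Z₀) (hκR : κ₀ ≤ R₀) (hrate : r + R ≤ (R₀ - κ₀) * ℓ) :
    ∑ j ∈ (S.filter (fun Z₀ => cl Z₀ = Z')).sigma I, ε * m j.1 j.2 ≤
      (ε * Real.exp c₀ * A₀ * K₀ * Real.exp (5 * R)) * Real.exp (-(r * d Z')) * Real.exp (-(R * (d Z' + 5))) := by
  classical
  set F := S.filter (fun Z₀ => cl Z₀ = Z') with hF
  have hmemF : ∀ Z₀ ∈ F, Z₀ ∈ S ∧ cl Z₀ = Z' := fun Z₀ h => Finset.mem_filter.1 h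
  -- per component: inner count, then split the rate and transfer the length
  have hcomp : ∀ Z₀ ∈ F, ∑ l ∈ I Z₀, ε * m Z₀ l ≤
      ε * Real.exp c₀ * Real.exp (-((R₀ - κ₀) * ℓ * d Z')) * Real.exp (-(κ₀ * dK Z₀)) := by
    intro Z₀ hZ₀
    obtain ⟨hS, hcl⟩ := hmemF Z₀ hZ₀
    rw [← Finset.mul_sum]
    have h1 := hinner Z₀ hS
    have h2 : Real.exp (-(R₀ * dK Z₀)) ≤ Real.exp (-((R₀ - κ₀) * ℓ * d Z')) * Real.exp (-(κ₀ * dK Z₀)) := by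
      rw [← Real.exp_add]
      refine Real.exp_le_exp.2 ?_
      have ht := htransfer Z₀ hS hcl
      nlinarith [mul_le_mul_of_nonneg_left ht (sub_nonneg.2 hκR)]
    calc ε * ∑ l ∈ I Z₀, m Z₀ l ≤ ε * (Real.exp c₀ * Real.exp (-(R₀ * dK Z₀))) := mul_le_mul_of_nonneg_left h1 hε
      _ ≤ ε * (Real.exp c₀ * (Real.exp (-((R₀ - κ₀) * ℓ * d Z')) * Real.exp (-(κ₀ * dK Z₀)))) :=
          mul_le_mul_of_nonneg_left (mul_le_mul_of_nonneg_left h2 (Real.exp_pos _).le) hε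
      _ = _ := by ring
  have hanch := fibreSum_le_card_anchor_mul S cubesK cl anc (fun Z₀ => Real.exp (-(κ₀ * dK Z₀)))
    (fun _ _ => (Real.exp_pos _).le) Z' hanchor h126
  calc ∑ j ∈ F.sigma I, ε * m j.1 j.2 = ∑ Z₀ ∈ F, ∑ l ∈ I Z₀, ε * m Z₀ l := Finset.sum_sigma _ _ _
    _ ≤ ∑ Z₀ ∈ F, ε * Real.exp c₀ * Real.exp (-((R₀ - κ₀) * ℓ * d Z')) * Real.exp (-(κ₀ * dK Z₀)) :=
        Finset.sum_le_sum hcomp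
    _ = ε * Real.exp c₀ * Real.exp (-((R₀ - κ₀) * ℓ * d Z')) * ∑ Z₀ ∈ F, Real.exp (-(κ₀ * dK Z₀)) := by
        rw [Finset.mul_sum]
    _ ≤ ε * Real.exp c₀ * Real.exp (-((R₀ - κ₀) * ℓ * d Z')) * ((anc Z').card * K₀) :=
        mul_le_mul_of_nonneg_left hanch (by positivity)
    _ ≤ ε * Real.exp c₀ * Real.exp (-((r + R) * d Z')) * (A₀ * K₀) := by
        refine mul_le_mul (mul_le_mul_of_nonneg_left (Real.exp_le_exp.2 (by nlinarith)) (by positivity))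
          (mul_le_mul_of_nonneg_right hA₀ hK₀) (by positivity) (by positivity)
    _ = (ε * Real.exp c₀ * A₀ * K₀ * Real.exp (5 * R)) * Real.exp (-(r * d Z')) * Real.exp (-(R * (d Z' + 5))) := by
        have : Real.exp (-((r + R) * d Z')) = Real.exp (5 * R) * Real.exp (-(r * d Z')) * Real.exp (-(R * (d Z' + 5))) := by
          rw [← Real.exp_add, ← Real.exp_add]; congr 1; ring
        rw [this]; ring

end Summit.QuantumFields.BalabanUV.T4Continuum.NE1p.DressedSmallFieldComponentCount

/-! ## §3 THE END: N0v's outer-label END with `hmember` DISCHARGED by §2 (components anchored to their closure) -/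

namespace Summit.QuantumFields.BalabanUV.T4Continuum.NE1p.DressedSmallFieldComponentCount

open Metric Set Complex MeasureTheory
open scoped BigOperators
open Literature.MathematicalPhysics.QuantumFieldTheory.Balaban1983to89 (LocDomainSys)
open Literature.MathematicalPhysics.QuantumFieldTheory.Balaban1983to89.B13FamilySum (coveringFamilies)
open Literature.MathematicalPhysics.QuantumFieldTheory.Balaban1983to89.T4OutputRate (Carriers)
open Literature.MathematicalPhysics.QuantumFieldTheory.Balaban1983to89.B13Resummation (locE Geometry)
open Summit.QuantumFields.BalabanUV.T4Continuum.B13HistMeasurable (MeasPotFrame B13HistM)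
open Summit.QuantumFields.BalabanUV.T4Continuum.B13TermParamGaussianBi (BiCore)
open Summit.QuantumFields.BalabanUV.T4Continuum.NE1p.DressedSmallFieldOuterCount (attachedPart_locE_le_of_coresAt_pencil_outerLabels)

section End

variable {C : Carriers} {P : MeasPotFrame C} {Op : Type*} [NormedAddCommGroup Op] [NormedSpace ℂ Op] {Dk : LocDomainSys}
  {CubeK : Type} [DecidableEq CubeK] {ι₀ : Type}
variable (D : LocDomainSys) {Cube : Type} [DecidableEq Cube] (G : Geometry D Cube) (Gk : Geometry Dk CubeK)
  {𝒴 : ℕ → (Σ _ : Finset Cube, Σ F : Finset D.Dom, ∀ Z ∈ F, (Σ _ : Dk.Dom, ι₀)) → Type*} {dom : ∀ k i, 𝒴 k i → C.Dom}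
  {β : ℕ → (Σ _ : Finset Cube, Σ F : Finset D.Dom, ∀ Z ∈ F, (Σ _ : Dk.Dom, ι₀)) → Type*} [∀ k i, MeasurableSpace (β k i)]
  {α : ℕ → (Σ _ : Finset Cube, Σ F : Finset D.Dom, ∀ Z ∈ F, (Σ _ : Dk.Dom, ι₀)) → Type*} [∀ k i, NormedAddCommGroup (α k i)]
  [∀ k i, InnerProductSpace ℝ (α k i)] [∀ k i, FiniteDimensional ℝ (α k i)] [∀ k i, MeasurableSpace (α k i)]
  [∀ k i, BorelSpace (α k i)]

open Classical in
/-- **THE ATTACHED PART FOR CORES INDEXED BY OUTER LABELS WHOSE INNER DATA ARE COMPONENTS WITH INNER LABELS, `hmember`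
DISCHARGED** (kernel; N0v's `attachedPart_locE_le_of_coresAt_pencil_outerLabels` ONCE BY NAME with inner data `κ Z′ := Σ _ : Dk.Dom, ι₀`
(a scale-`k` component `Z₀` with `cl Z₀ = Z′` and one of its inner labels `l ∈ I Z₀`), inner finsets `J Z′ := (univ.filter (cl · = Z′)).sigma I`,
weights `ε·m Z₀ l`, and the per-member bound SUPPLIED by §2's `memberSum_le_of_anchor` from: the components' inner counts `hinner`
(N0u's currency `Σ_l m Z₀ l ≤ e^{c₀}e^{−R₀ d_k Z₀}` — displayed here, N0u's `innerCount_le_decay` supplies it for its labels), the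
ANCHOR `hanchor`∕`hA` (every component whose closure is `Z′` contains a cube of `anc Z′`, `#anc Z′ ≤ Aₐ` — p. 19–20 «an additional sum over
(L+2)⁴ cubes □′ from π_k, the cubes touching a fixed LM-cube in Z′_i», KIND), the (1.26)∕(1.28)-KIND anchored sum = `Gk.ineq126` BY NAME,
the (2.36)-KIND transfer `htransfer` (`ℓ·d(Z′) ≤ d_k(Z₀)` for `cl Z₀ = Z′`; tree: `B13.Ineq236With` shape, repaired factor G-B13-09R) and
the rate bookkeeping `Gk.κ₀ ≤ R₀`, `r + R ≤ (R₀ − Gk.κ₀)·ℓ`; amplitude `a := ε·e^{c₀}·Aₐ·Gk.K₀·e^{5R}` in N0v's (2.29) clause `h229`.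
Every other binder VERBATIM N0v's.  Conclusion as N0s's. [folklore] -/
theorem attachedPart_locE_le_of_coresAt_pencil_components {Win : Set (ℕ → ℝ)}
    {ctr : ℕ → (ℕ → ℝ) → C.BgB → Op × B13HistM P} {ROp RHist R' : ℕ → ℝ}
    (𝔊 : ∀ k i, C.Dom → BiCore P (dom k i) Op (β k i) (α k i))
    {mq bq N₀ : ℕ → (Σ _ : Finset Cube, Σ F : Finset D.Dom, ∀ Z ∈ F, (Σ _ : Dk.Dom, ι₀)) → C.Dom → ℝ}
    (hroom : ∀ k, ROp k < R' k)
    (hm : ∀ k, ∀ g ∈ Win, ∀ (U : C.BgB) (X : C.Dom), C.scale X = k → ∀ i, 0 < mq k i X)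
    (hN : ∀ k, ∀ g ∈ Win, ∀ (U : C.BgB) (X : C.Dom), C.scale X = k → ∀ i,
      (∀ o ∈ ball (ctr k g U).1 (R' k), AEStronglyMeasurable ((𝔊 k i X).N o) (𝔊 k i X).lam) ∧
      (∀ p, DifferentiableOn ℂ (fun o => (𝔊 k i X).N o p) (ball (ctr k g U).1 (R' k))) ∧
      (∀ o ∈ ball (ctr k g U).1 (R' k), ∀ p, ‖(𝔊 k i X).N o p‖ ≤ N₀ k i X))
    (hq : ∀ k, ∀ g ∈ Win, ∀ (U : C.BgB) (X : C.Dom), C.scale X = k → ∀ i,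
      (∀ o ∈ ball (ctr k g U).1 (R' k),
        AEStronglyMeasurable (Function.uncurry ((𝔊 k i X).q o)) ((𝔊 k i X).lam.prod volume)) ∧
      (∀ p v, DifferentiableOn ℂ (fun o => (𝔊 k i X).q o p v) (ball (ctr k g U).1 (R' k))) ∧
      (∀ o ∈ ball (ctr k g U).1 (R' k), ∀ p v, mq k i X * ‖v‖ ^ 2 - bq k i X ≤ ((𝔊 k i X).q o p v).re))
    {k : ℕ} {g : ℕ → ℝ} (hg : g ∈ Win) {U : C.BgB} {o : Op} {h₀ w : B13HistM P} {ϱ : ℝ}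
    (hO : ‖o - (ctr k g U).1‖ ≤ ROp k) (hH : ‖h₀ - (ctr k g U).2‖ + ϱ * ‖w‖ ≤ RHist k)
    {emb : D.Dom → C.Dom} (hscale : ∀ Z, C.scale (emb Z) = k)
    {terms : D.Dom → Finset (Σ _ : Finset Cube, Σ F : Finset D.Dom, ∀ Z ∈ F, (Σ _ : Dk.Dom, ι₀))} {act : ℂ → D.Dom → ℂ}
    (hact : ∀ σ ∈ ball (0 : ℂ) ϱ, ∀ Z, act σ Z = ∑ i ∈ terms Z, (𝔊 k i (emb Z)).termAt o (h₀ + σ • w))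
    {A₀ A₁ Rkp r₁ b₅ : ℝ} {X₀ : D.Dom} (hA₀ : 0 ≤ A₀) (hA₁ : 0 ≤ A₁) (hr₁ : 0 ≤ r₁) (hb : r₁ * 5 ≤ b₅)
    (hrate : r₁ + 2 * G.κ₀ + 2 ≤ Rkp) (hsmall : (A₀ + ϱ * A₁) * Real.exp (b₅ + 1) * G.K₀ * G.ν * G.c₁ ≤ 1)
    -- the inner data of the components (N0u's currency, displayed) and the anchored closure (N0w)
    (I : Dk.Dom → Finset ι₀) (m : Dk.Dom → ι₀ → ℝ) (hm0 : ∀ Z₀ l, 0 ≤ m Z₀ l) (cl : Dk.Dom → D.Dom)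
    (anc : D.Dom → Finset CubeK) {ε c₀ R₀ Aₐ ℓ r R c' v : ℝ} (hε : 0 ≤ ε) (hv : 0 ≤ v)
    (hinner : ∀ Z₀, ∑ l ∈ I Z₀, m Z₀ l ≤ Real.exp c₀ * Real.exp (-(R₀ * Dk.dj Z₀)))
    (hanchor : ∀ Z₀ Z', cl Z₀ = Z' → ∃ c ∈ anc Z', c ∈ Gk.cubes Z₀) (hA : ∀ Z', ((anc Z').card : ℝ) ≤ Aₐ)
    (htransfer : ∀ Z₀ Z', cl Z₀ = Z' → ℓ * D.dj Z' ≤ Dk.dj Z₀) (hκR : Gk.κ₀ ≤ R₀) (hrate2 : r + R ≤ (R₀ - Gk.κ₀) * ℓ)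
    (hκ : G.κ₀ + 1 ≤ r) (h229 : Real.exp 1 * G.K₀ * G.c₁ * (ε * Real.exp c₀ * Aₐ * Gk.K₀ * Real.exp (5 * R)) ≤ 1)
    (hlink : ∀ Z, ∀ W ⊆ G.cubes Z, ∀ F ∈ coveringFamilies Finset.univ G.cubes (G.cubes Z \ W),
      D.dj Z - c' * W.card + 5 ≤ ∑ Z' ∈ F, (D.dj Z' + 5))
    (hRR : Rkp ≤ R - G.c₁ * (v * Real.exp (R * c')))
    (hadm : ∀ Z, ∀ l ∈ terms Z, l.1 ⊆ G.cubes Z ∧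
      l.2.1 ∈ coveringFamilies Finset.univ G.cubes (G.cubes Z \ l.1) ∧
      ∀ Z' (h : Z' ∈ l.2.1), l.2.2 Z' h ∈ ((Finset.univ : Finset Dk.Dom).filter (fun Z₀ => cl Z₀ = Z')).sigma I)
    (hAmp : ∀ Z, G.cubes Z ⊆ G.cubes X₀ → ∀ l ∈ terms Z,
      (𝔊 k l (emb Z)).lam.real univ * ((𝔊 k l (emb Z)).wB * N₀ k l (emb Z) * Real.exp (bq k l (emb Z))) *
          (Real.pi / (mq k l (emb Z) / 2)) ^ (Module.finrank ℝ (α k l) / 2 : ℝ) *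
        Real.exp ((𝔊 k l (emb Z)).N₁ * (‖h₀‖ + ϱ * ‖w‖)) ≤
      (A₀ + ϱ * A₁) * (v ^ l.1.card * ∏ x ∈ l.2.1.attach, (ε * m (l.2.2 x.1 x.2).1 (l.2.2 x.1 x.2).2)))
    (hϱ : 2 ≤ ϱ) (hϱA : A₀ ≤ ϱ * A₁) :
    ‖locE G.ι G.cubes (act 1) (G.cubes X₀) - locE G.ι G.cubes (act 0) (G.cubes X₀)‖ ≤
      4 * (Real.exp 1 * G.ν * G.c₁ * G.K₀ ^ 2) * A₁ * Real.exp (-(r₁ * D.dj X₀)) := by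
  have hA0 : (0 : ℝ) ≤ Aₐ := le_trans (Nat.cast_nonneg _) (hA X₀)
  have ha : 0 ≤ ε * Real.exp c₀ * Aₐ * Gk.K₀ * Real.exp (5 * R) :=
    mul_nonneg (mul_nonneg (mul_nonneg (mul_nonneg hε (Real.exp_pos _).le) hA0) Gk.K₀_nonneg) (Real.exp_pos _).le
  exact attachedPart_locE_le_of_coresAt_pencil_outerLabels D G 𝔊 hroom hm hN hq hg hO hH hscale hact hA₀ hA₁ hr₁ hb hrate hsmall
    (fun Z' => ((Finset.univ : Finset Dk.Dom).filter (fun Z₀ => cl Z₀ = Z')).sigma I) (fun _ j => ε * m j.1 j.2)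
    (fun _ j => mul_nonneg hε (hm0 _ _)) ha hv hκ h229
    (fun Z' => memberSum_le_of_anchor Finset.univ Gk.cubes Dk.dj cl anc D.dj I m hε Gk.K₀_nonneg Z' (D.dj_nonneg Z')
      (fun Z₀ _ => hinner Z₀) (fun c _ => Gk.ineq126 c) (fun Z₀ _ h => hanchor Z₀ Z' h) (hA Z')
      (fun Z₀ _ h => htransfer Z₀ Z' h) hκR hrate2)
    hlink hRR hadm hAmp hϱ hϱA

end End

end Summit.QuantumFields.BalabanUV.T4Continuum.NE1p.DressedSmallFieldComponentCount

end
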